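import Mathlib.Analysis.SpecialFunctions.Elliptic.Weierstrass
import Mathlib.Analysis.Complex.CauchyIntegral
import Mathlib.Analysis.Normed.Module.FiniteDimension
import Mathlib.LinearAlgebra.Projection
import Literature.NumberTheory.Transcendental.OnePeriods
import HarnessLib

/-!
# A Kronecker lemma for the lattice `Λ^γ`: analytic functions vanishing on `𝔷 + Λ^γ`

Topic: `Literature/NumberTheory/Transcendental`. A brick of the discharge of the named fact
`Literature.NumberTheory.Transcendental.philippon1986_std` (classification of the obstruction
subgroups of Philippon's zero estimate on `M_κ = 𝔾ₘ^β × P_κ` with an arbitrary number `|γ|` of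
factors `E = ℂ/Λ` WITHOUT complex multiplication). The only place where `End(E) = ℤ` enters the
classification is the following analytic statement about the abelian part
(`PeriodPair.eq_zero_on_ratHull`):

  Let `g` be an entire function on `ℂ^γ` whose zero set is invariant under `Λ^γ`, vanishing on a
  complex subspace `𝔷`. If `Λ` has no complex multiplication, `g` vanishes on the RATIONAL HULL
  `ratHull 𝔷 = {z : ⟨c, z⟩ = 0 for all c ∈ ℚ^γ with ⟨c, 𝔷⟩ = 0}` of `𝔷`

— the analytic shadow of "the Zariski closure of a complex subtorus direction of `E^γ` is the
abelian subvariety `{Cz = 0}` it generates, `End(E) = ℤ`". Proof (`eq_zero_on_ratHull`): take a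
complex subspace `W ⊇ 𝔷` inside the zero set `Z` of maximal dimension and a coordinate complement
`ℂ^B` of `W` with the projection `P` along `W`. DICHOTOMY on the subgroup `P(Λ^γ) ⊆ ℂ^B`:

* if it has arbitrarily small non-zero elements, their directions accumulate at a unit vector `u`
  with `ℝu ⊆ closure P(Λ^γ)` (`exists_line_subset_closure`, `⌊t/‖s‖⌋ s → t u`); as
  `P(λ) ∈ W + Λ^γ ⊆ Z` and `Z` is closed and `W`-invariant, `W + ℝu ⊆ Z`, and by the one-variable
  identity theorem (`eq_zero_add_I_smul_of_real`) `W + ℂu ⊆ Z` — contradicting maximality;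
* if it is uniformly discrete, it is a discrete group containing the full lattice `Λ^B`, so some
  `N ≥ 1` multiplies all the `P(ω_i e_b)` into `Λ^B` (finitely many reductions into a fundamental
  domain, pigeonhole); then `x = N·P(e_b)_{b'}` satisfies `xω₁, xω₂ ∈ Λ`, i.e. `xΛ ⊆ Λ`, so
  `x ∈ ℤ` by `¬ HasCM` (`int_of_mul_omega_mem`): `P` has a rational matrix and `W = ker P` is cut
  out by rational linear forms (`mem_of_forall_zRel`), whence `ratHull 𝔷 ⊆ W ⊆ Z`.

Everything is PROVED; the only definitions are `latt` (lattice vectors), `zRel` (rational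
relations), `ratHull`, the coordinate spans and the coordinatewise reduction modulo `Λ`.

## References

* D. Bertrand, P. Philippon, *Sous-groupes algébriques de groupes algébriques commutatifs*,
  Illinois J. Math. 32 (1988), 263–280 (abelian subvarieties of `E^γ`, `End E = ℤ`). [folklore]
* Yu. V. Nesterenko, P. Philippon (eds.), *Introduction to Algebraic Independence Theory*,
  LNM 1752, Springer 2001, Ch. 11 (D. Roy), Thm. 4.1. [NesterenkoPhilippon2001]
-/

noncomputable section

open Complex Filter Topology Module

namespace Literature.NumberTheory.Transcendental

namespace Kron

variable (L : PeriodPair) {γ : Type} [Fintype γ] [DecidableEq γ]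

/-! ### No complex multiplication: `xΛ ⊆ Λ ⇒ x ∈ ℤ` -/

/-- **`End(Λ) = ℤ`**: if `xω₁, xω₂ ∈ Λ` and `Λ` has no complex multiplication then `x ∈ ℤ`. [folklore] -/
theorem int_of_mul_omega_mem (hCM : ¬ L.HasCM) {x : ℂ} (h1 : x * L.ω₁ ∈ L.lattice) (h2 : x * L.ω₂ ∈ L.lattice) :
    ∃ n : ℤ, x = n := by
  by_contra hn
  refine hCM ⟨x, fun n h => hn ⟨n, h⟩, fun l hl => ?_⟩
  obtain ⟨m, n, rfl⟩ := PeriodPair.mem_lattice.mp hl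
  have : x * (m * L.ω₁ + n * L.ω₂) = m * (x * L.ω₁) + n * (x * L.ω₂) := by ring
  rw [this]
  refine L.lattice.add_mem ?_ ?_
  · simpa [zsmul_eq_mul] using L.lattice.smul_mem m h1
  · simpa [zsmul_eq_mul] using L.lattice.smul_mem n h2

/-! ### Lattice vectors, rational relations, the rational hull -/

/-- The lattice vector `(m_b ω₁ + n_b ω₂)_b ∈ Λ^γ`. [folklore] -/
def latt (m n : γ → ℤ) : γ → ℂ := fun b => (m b : ℂ) * L.ω₁ + (n b : ℂ) * L.ω₂

omit [Fintype γ] [DecidableEq γ] in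
/-- `Λ^γ` is closed under addition. [folklore] -/
theorem latt_add (m n m' n' : γ → ℤ) : latt L m n + latt L m' n' = latt L (m + m') (n + n') := by
  funext b; simp [latt]; ring

omit [Fintype γ] [DecidableEq γ] in
/-- `Λ^γ` is closed under negation. [folklore] -/
theorem neg_latt (m n : γ → ℤ) : -latt L m n = latt L (-m) (-n) := by
  funext b; simp [latt]; ring

omit [Fintype γ] [DecidableEq γ] in
/-- Integer multiples of lattice vectors. [folklore] -/
theorem zsmul_latt (k : ℤ) (m n : γ → ℤ) : k • latt L m n = latt L (k • m) (k • n) := by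
  funext b; simp [latt]; ring

/-- **The rational relations of a complex subspace** `𝔷 ≤ ℂ^γ`: `c ∈ ℚ^γ` with `⟨c, z⟩ = 0` on `𝔷`.
[folklore] -/
def zRel (𝔷 : Submodule ℂ (γ → ℂ)) : Submodule ℚ (γ → ℚ) where
  carrier := {c | ∀ z ∈ 𝔷, ∑ b, (c b : ℂ) * z b = 0}
  zero_mem' := fun z _ => by simp
  add_mem' := by
    intro c c' hc hc' z hz
    simp only [Pi.add_apply, Rat.cast_add, add_mul, Finset.sum_add_distrib, hc z hz, hc' z hz, add_zero]
  smul_mem' := by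
    intro a c hc z hz
    simp only [Pi.smul_apply, smul_eq_mul, Rat.cast_mul, mul_assoc, ← Finset.mul_sum, hc z hz, mul_zero]

omit [DecidableEq γ] in
/-- Membership in `zRel`. [folklore] -/
theorem mem_zRel_iff {𝔷 : Submodule ℂ (γ → ℂ)} {c : γ → ℚ} :
    c ∈ zRel 𝔷 ↔ ∀ z ∈ 𝔷, ∑ b, (c b : ℂ) * z b = 0 := Iff.rfl

omit [DecidableEq γ] in
/-- `zRel` is antitone. [folklore] -/
theorem zRel_antitone {𝔷 𝔷' : Submodule ℂ (γ → ℂ)} (h : 𝔷 ≤ 𝔷') : zRel 𝔷' ≤ zRel 𝔷 :=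
  fun _ hc z hz => hc z (h hz)

/-- **The rational hull** of `𝔷`: the complex subspace cut out by the rational relations of `𝔷`
(the Lie algebra of the smallest abelian subvariety `{Cz = 0}` of `E^γ` containing `exp 𝔷`,
`End E = ℤ`). [folklore] -/
def ratHull (𝔷 : Submodule ℂ (γ → ℂ)) : Submodule ℂ (γ → ℂ) where
  carrier := {z | ∀ c ∈ zRel 𝔷, ∑ b, (c b : ℂ) * z b = 0}
  zero_mem' := fun c _ => by simp
  add_mem' := by
    intro z z' hz hz' c hc
    simp only [Pi.add_apply, mul_add, Finset.sum_add_distrib, hz c hc, hz' c hc, add_zero]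
  smul_mem' := by
    intro a z hz c hc
    simp only [Pi.smul_apply, smul_eq_mul, mul_left_comm _ a, ← Finset.mul_sum, hz c hc, mul_zero]

omit [DecidableEq γ] in
/-- Membership in the rational hull. [folklore] -/
theorem mem_ratHull_iff {𝔷 : Submodule ℂ (γ → ℂ)} {z : γ → ℂ} :
    z ∈ ratHull 𝔷 ↔ ∀ c ∈ zRel 𝔷, ∑ b, (c b : ℂ) * z b = 0 := Iff.rfl

omit [DecidableEq γ] in
/-- `𝔷 ≤ ratHull 𝔷`. [folklore] -/
theorem le_ratHull (𝔷 : Submodule ℂ (γ → ℂ)) : 𝔷 ≤ ratHull 𝔷 := fun _ hz _ hc => hc _ hz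

omit [DecidableEq γ] in
/-- A subspace cut out by its rational relations and containing `𝔷` contains `ratHull 𝔷`. [folklore] -/
theorem ratHull_le_of_le {𝔷 W : Submodule ℂ (γ → ℂ)} (h : 𝔷 ≤ W)
    (hW : ∀ z, (∀ c ∈ zRel W, ∑ b, (c b : ℂ) * z b = 0) → z ∈ W) : ratHull 𝔷 ≤ W :=
  fun z hz => hW z fun c hc => hz c (zRel_antitone h hc)

/-! ### Coordinate complements -/

/-- The complex coordinate subspace `span_ℂ {e_b : b ∈ B}`. [folklore] -/
def cspan (B : Finset γ) : Submodule ℂ (γ → ℂ) := Submodule.span ℂ ((fun b => Pi.single b (1 : ℂ)) '' (B : Set γ))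

omit [Fintype γ] in
/-- `e_b ∈ cspan B` for `b ∈ B`. [folklore] -/
theorem single_mem_cspan {B : Finset γ} {b : γ} (hb : b ∈ B) : (Pi.single b (1 : ℂ) : γ → ℂ) ∈ cspan B :=
  Submodule.subset_span ⟨b, hb, rfl⟩

omit [Fintype γ] in
/-- Vectors of `cspan B` vanish off `B`. [folklore] -/
theorem apply_eq_zero_of_mem_cspan {B : Finset γ} {v : γ → ℂ} (hv : v ∈ cspan B) {b : γ} (hb : b ∉ B) : v b = 0 := by
  let T : Submodule ℂ (γ → ℂ) :=
    { carrier := {v | v b = 0}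
      zero_mem' := by simp
      add_mem' := by intro x y hx hy; simp_all
      smul_mem' := by intro a x hx; simp_all }
  have hle : cspan B ≤ T := by
    refine Submodule.span_le.mpr ?_
    rintro _ ⟨b', hb', rfl⟩
    show (Pi.single b' (1 : ℂ) : γ → ℂ) b = 0
    rw [Pi.single_apply, if_neg]
    rintro rfl
    exact hb hb'
  exact hle hv

omit [Fintype γ] in
/-- Vectors supported on `B` lie in `cspan B`. [folklore] -/
theorem mem_cspan_of_support {B : Finset γ} {v : γ → ℂ} (hv : ∀ b, b ∉ B → v b = 0) : v ∈ cspan B := by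
  have : v = ∑ b ∈ B, v b • (Pi.single b (1 : ℂ) : γ → ℂ) := by
    funext b'
    simp only [Finset.sum_apply, Pi.smul_apply, smul_eq_mul]
    by_cases hb' : b' ∈ B
    · rw [Finset.sum_eq_single b' (fun b _ hb => by rw [Pi.single_eq_of_ne (Ne.symm hb), mul_zero])
        (fun h => absurd hb' h)]
      simp
    · rw [hv b' hb']
      exact (Finset.sum_eq_zero fun b hb => by rw [Pi.single_eq_of_ne (ne_of_mem_of_not_mem hb hb').symm, mul_zero]).symm
  rw [this]
  exact Submodule.sum_mem _ fun b hb => Submodule.smul_mem _ _ (single_mem_cspan hb)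

/-- **A coordinate complement**: every complex subspace `W ≤ ℂ^γ` has a complement spanned by
coordinate vectors. [folklore] -/
theorem exists_isCompl_cspan (W : Submodule ℂ (γ → ℂ)) : ∃ B : Finset γ, IsCompl W (cspan B) := by
  classical
  -- a maximal `B` with `W ⊓ cspan B = ⊥`
  let good : Finset (Finset γ) := Finset.univ.filter fun B => Disjoint W (cspan B)
  have hne : good.Nonempty := ⟨∅, Finset.mem_filter.mpr ⟨Finset.mem_univ _, by
    rw [cspan, Finset.coe_empty, Set.image_empty, Submodule.span_empty]; exact disjoint_bot_right⟩⟩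
  obtain ⟨B, hB, hmax⟩ := Finset.exists_max_image good Finset.card hne
  have hdis : Disjoint W (cspan B) := (Finset.mem_filter.mp hB).2
  refine ⟨B, IsCompl.of_le (disjoint_iff_inf_le.mp hdis) ?_⟩
  -- `W ⊔ cspan B = ⊤`, else enlarge `B`
  rw [top_le_iff]
  by_contra htop
  have : ∃ b, (Pi.single b (1 : ℂ) : γ → ℂ) ∉ W ⊔ cspan B := by
    by_contra hall
    simp only [not_exists, not_not] at hall
    apply htop
    rw [eq_top_iff]
    intro v _
    have hv : v = ∑ b, v b • (Pi.single b (1 : ℂ) : γ → ℂ) := by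
      funext b'; simp [Finset.sum_apply, Pi.single_apply]
    rw [hv]
    exact Submodule.sum_mem _ fun b _ => Submodule.smul_mem _ _ (hall b)
  obtain ⟨b, hb⟩ := this
  have hbB : b ∉ B := fun h => hb (Submodule.mem_sup_right (single_mem_cspan h))
  have hdis' : Disjoint W (cspan (insert b B)) := by
    rw [Submodule.disjoint_def]
    intro x hxW hxC
    -- `x = y + a e_b` with `y ∈ cspan B`
    have hsplit : ∃ a : ℂ, ∃ y ∈ cspan B, x = y + a • (Pi.single b (1 : ℂ) : γ → ℂ) := by
      rw [cspan, Finset.coe_insert, Set.image_insert_eq, Submodule.span_insert] at hxC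
      obtain ⟨y₁, hy₁, y₂, hy₂, rfl⟩ := Submodule.mem_sup.mp hxC
      obtain ⟨a, rfl⟩ := Submodule.mem_span_singleton.mp hy₁
      exact ⟨a, y₂, hy₂, by rw [add_comm]⟩
    obtain ⟨a, y, hy, rfl⟩ := hsplit
    by_cases ha : a = 0
    · subst ha
      rw [zero_smul, add_zero] at hxW ⊢
      exact (Submodule.disjoint_def.mp hdis) y hxW hy
    · exfalso
      apply hb
      have : (Pi.single b (1 : ℂ) : γ → ℂ) = a⁻¹ • ((y + a • Pi.single b (1 : ℂ)) - y) := by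
        rw [add_sub_cancel_left, smul_smul, inv_mul_cancel₀ ha, one_smul]
      rw [this]
      exact Submodule.smul_mem _ _ (Submodule.sub_mem _ (Submodule.mem_sup_left hxW)
        (Submodule.mem_sup_right hy))
  have hgood : insert b B ∈ good := Finset.mem_filter.mpr ⟨Finset.mem_univ _, hdis'⟩
  have := hmax _ hgood
  rw [Finset.card_insert_of_notMem hbB] at this
  omega

/-! ### Small elements of a subgroup give a line in its closure -/

omit [DecidableEq γ] in
/-- **Directions of small elements accumulate at a line**: if an additive subgroup `S` of `ℂ^γ`
inside the complex subspace `F` has arbitrarily small non-zero elements, then some real line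
`ℝu`, `0 ≠ u ∈ F`, lies in the closure of `S` (`⌊t/‖s‖⌋ · s → t u` along a subsequence of
directions `s/‖s‖ → u`). [folklore] -/
theorem exists_line_subset_closure (S : AddSubgroup (γ → ℂ)) (F : Submodule ℂ (γ → ℂ))
    (hSF : (S : Set (γ → ℂ)) ⊆ F) (hS : ∀ ε : ℝ, 0 < ε → ∃ s ∈ S, s ≠ 0 ∧ ‖s‖ < ε) :
    ∃ u ∈ F, u ≠ 0 ∧ ∀ t : ℝ, ((t : ℂ) • u) ∈ closure (S : Set (γ → ℂ)) := by
  choose s hsS hs0 hsn using fun n : ℕ => hS (1 / ((n : ℝ) + 1)) (by positivity)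
  have hspos : ∀ n, 0 < ‖s n‖ := fun n => norm_pos_iff.mpr (hs0 n)
  -- unit directions and a convergent subsequence
  set u : ℕ → (γ → ℂ) := fun n => ((‖s n‖⁻¹ : ℝ) : ℂ) • s n with hu
  have hu1 : ∀ n, ‖u n‖ = 1 := by
    intro n
    rw [hu, norm_smul, Complex.norm_real, Real.norm_eq_abs, abs_of_pos (inv_pos.mpr (hspos n)),
      inv_mul_cancel₀ (hspos n).ne']
  have husphere : ∀ n, u n ∈ Metric.sphere (0 : γ → ℂ) 1 := fun n => by simp [hu1 n]
  obtain ⟨a, ha, φ, hφ, hlim⟩ := (isCompact_sphere (0 : γ → ℂ) 1).tendsto_subseq husphere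
  have ha1 : ‖a‖ = 1 := by simpa using ha
  have huF : ∀ n, u n ∈ F := fun n => F.smul_mem _ (hSF (hsS n))
  have haF : a ∈ F := (F.closed_of_finiteDimensional).mem_of_tendsto hlim (Eventually.of_forall fun n => huF (φ n))
  refine ⟨a, haF, fun h => by simp [h] at ha1, fun t => ?_⟩
  -- `⌊t/‖s‖⌋ s → t a`
  set r : ℕ → ℝ := fun n => ‖s (φ n)‖ with hr
  have hrpos : ∀ n, 0 < r n := fun n => hspos (φ n)
  have hr0 : Tendsto r atTop (𝓝 0) := by
    have h1 : Tendsto (fun n : ℕ => 1 / ((n : ℝ) + 1)) atTop (𝓝 0) := tendsto_one_div_add_atTop_nhds_zero_nat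
    refine squeeze_zero (fun n => (hrpos n).le) (fun n => ?_) h1
    exact (hsn (φ n)).le.trans (by
      gcongr
      exact_mod_cast hφ.id_le n)
  set k : ℕ → ℤ := fun n => ⌊t / r n⌋ with hk
  set c : ℕ → ℝ := fun n => (k n : ℝ) * r n with hc
  have hct : Tendsto c atTop (𝓝 t) := by
    have hbd : ∀ n, |c n - t| ≤ r n := by
      intro n
      have h1 := Int.floor_le (t / r n)
      have h2 := Int.lt_floor_add_one (t / r n)
      have e1 : (k n : ℝ) * r n ≤ t := by
        have := mul_le_mul_of_nonneg_right h1 (hrpos n).le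
        rwa [div_mul_cancel₀ _ (hrpos n).ne'] at this
      have e2 : t < ((k n : ℝ) + 1) * r n := by
        have := mul_lt_mul_of_pos_right h2 (hrpos n)
        rwa [div_mul_cancel₀ _ (hrpos n).ne'] at this
      rw [abs_le]
      constructor <;> nlinarith
    rw [tendsto_iff_norm_sub_tendsto_zero]
    exact squeeze_zero (fun n => norm_nonneg _) (fun n => by rw [Real.norm_eq_abs]; exact hbd n) hr0
  have hx : Tendsto (fun n => ((c n : ℝ) : ℂ) • u (φ n)) atTop (𝓝 ((t : ℂ) • a)) :=
    ((Complex.continuous_ofReal.tendsto t).comp hct).smul hlim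
  have hxS : ∀ n, ((c n : ℝ) : ℂ) • u (φ n) ∈ S := by
    intro n
    have : ((c n : ℝ) : ℂ) • u (φ n) = (k n) • s (φ n) := by
      have hne : ((‖s (φ n)‖ : ℝ) : ℂ) ≠ 0 := by exact_mod_cast (hspos (φ n)).ne'
      rw [hu, smul_smul, hc, ← Int.cast_smul_eq_zsmul ℂ (k n) (s (φ n))]
      congr 1
      show (((k n : ℝ) * r n : ℝ) : ℂ) * ((‖s (φ n)‖⁻¹ : ℝ) : ℂ) = ((k n : ℤ) : ℂ)
      rw [hr]
      push_cast
      field_simp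
    rw [this]
    exact S.zsmul_mem (hsS (φ n)) (k n)
  exact mem_closure_of_tendsto hx (Eventually.of_forall hxS)

/-! ### Complexification by the identity theorem -/

omit [DecidableEq γ] in
/-- **An entire function vanishing on a real line vanishes on the complex line.** [folklore] -/
theorem eq_zero_smul_of_real {g : (γ → ℂ) → ℂ} (hg : Differentiable ℂ g) {x y : γ → ℂ}
    (h : ∀ t : ℝ, g (x + (t : ℂ) • y) = 0) (τ : ℂ) : g (x + τ • y) = 0 := by
  set f : ℂ → ℂ := fun τ => g (x + τ • y) with hf
  have hfd : Differentiable ℂ f := hg.comp ((differentiable_const x).add (differentiable_id.smul_const y))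
  have hfa : AnalyticOnNhd ℂ f Set.univ := fun z _ => hfd.analyticAt z
  -- zeros `1/(n+1)` accumulating at `0`
  have hseq : Tendsto (fun n : ℕ => (((1 / ((n : ℝ) + 1) : ℝ)) : ℂ)) atTop (𝓝[≠] 0) := by
    rw [tendsto_nhdsWithin_iff]
    refine ⟨?_, Eventually.of_forall fun n => ?_⟩
    · have := (Complex.continuous_ofReal.tendsto 0).comp tendsto_one_div_add_atTop_nhds_zero_nat
      rw [Complex.ofReal_zero] at this
      exact this
    · have : (0 : ℝ) < 1 / ((n : ℝ) + 1) := by positivity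
      simp only [Set.mem_compl_iff, Set.mem_singleton_iff, Complex.ofReal_eq_zero]
      exact this.ne'
  have hfreq : ∃ᶠ z in 𝓝[≠] (0 : ℂ), f z = 0 :=
    hseq.frequently (Frequently.of_forall fun n => h _)
  have := hfa.eqOn_zero_of_preconnected_of_frequently_eq_zero isPreconnected_univ (Set.mem_univ 0) hfreq
  exact this (Set.mem_univ τ)

/-! ### Reduction modulo `Λ` coordinatewise -/

/-- Integer parts of the first real coordinates. [folklore] -/
def mfl (v : γ → ℂ) : γ → ℤ := fun b => ⌊L.basis.repr (v b) 0⌋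

/-- Integer parts of the second real coordinates. [folklore] -/
def nfl (v : γ → ℂ) : γ → ℤ := fun b => ⌊L.basis.repr (v b) 1⌋

/-- Reduction of every coordinate into the fundamental parallelogram. [folklore] -/
def red (v : γ → ℂ) : γ → ℂ := v - latt L (mfl L v) (nfl L v)

omit [Fintype γ] [DecidableEq γ] in
/-- Real coordinates of a complex number in the basis `(ω₁, ω₂)`. [folklore] -/
theorem repr_sum_eq (x : ℂ) : ((L.basis.repr x 0 : ℝ) : ℂ) * L.ω₁ + ((L.basis.repr x 1 : ℝ) : ℂ) * L.ω₂ = x := by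
  have h := L.basis.sum_repr x
  rw [Fin.sum_univ_two, PeriodPair.basis_zero, PeriodPair.basis_one] at h
  simpa [Complex.real_smul] using h

omit [Fintype γ] [DecidableEq γ] in
/-- The reduced coordinates. [folklore] -/
theorem red_apply (v : γ → ℂ) (b : γ) :
    red L v b = ((Int.fract (L.basis.repr (v b) 0) : ℝ) : ℂ) * L.ω₁ + ((Int.fract (L.basis.repr (v b) 1) : ℝ) : ℂ) * L.ω₂ := by
  simp only [red, Pi.sub_apply, latt, mfl, nfl, Int.fract]
  have h := repr_sum_eq L (v b)
  push_cast
  linear_combination -h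

omit [Fintype γ] [DecidableEq γ] in
/-- **The reduced vectors are bounded.** [folklore] -/
theorem norm_red_apply_le (v : γ → ℂ) (b : γ) : ‖red L v b‖ ≤ ‖L.ω₁‖ + ‖L.ω₂‖ := by
  rw [red_apply]
  refine (norm_add_le _ _).trans (add_le_add ?_ ?_)
  · rw [norm_mul, Complex.norm_real, Real.norm_eq_abs, abs_of_nonneg (Int.fract_nonneg _)]
    exact mul_le_of_le_one_left (norm_nonneg _) (Int.fract_lt_one _).le
  · rw [norm_mul, Complex.norm_real, Real.norm_eq_abs, abs_of_nonneg (Int.fract_nonneg _)]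
    exact mul_le_of_le_one_left (norm_nonneg _) (Int.fract_lt_one _).le

omit [DecidableEq γ] in
/-- The reduced vectors are bounded (sup norm). [folklore] -/
theorem norm_red_le (v : γ → ℂ) : ‖red L v‖ ≤ ‖L.ω₁‖ + ‖L.ω₂‖ :=
  (pi_norm_le_iff_of_nonneg (by positivity)).mpr fun b => norm_red_apply_le L v b

omit [Fintype γ] [DecidableEq γ] in
/-- A vanishing coordinate has vanishing integer parts. [folklore] -/
theorem mfl_eq_zero {v : γ → ℂ} {b : γ} (hv : v b = 0) : mfl L v b = 0 ∧ nfl L v b = 0 := by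
  simp [mfl, nfl, hv]

/-! ### The subgroup `P(Λ^γ)` -/

/-- The image of `Λ^γ` under a linear map, as an additive subgroup. [folklore] -/
def lattImage (P : (γ → ℂ) →ₗ[ℂ] (γ → ℂ)) : AddSubgroup (γ → ℂ) where
  carrier := {v | ∃ m n : γ → ℤ, v = P (latt L m n)}
  zero_mem' := ⟨0, 0, by
    have : latt L (0 : γ → ℤ) 0 = 0 := by funext b; simp [latt]
    rw [this, map_zero]⟩
  add_mem' := by
    rintro _ _ ⟨m, n, rfl⟩ ⟨m', n', rfl⟩
    exact ⟨m + m', n + n', by rw [← map_add, latt_add]⟩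
  neg_mem' := by
    rintro _ ⟨m, n, rfl⟩
    exact ⟨-m, -n, by rw [← map_neg, neg_latt]⟩

omit [Fintype γ] [DecidableEq γ] in
/-- Differences in `P(Λ^γ)`. [folklore] -/
theorem map_latt_sub (P : (γ → ℂ) →ₗ[ℂ] (γ → ℂ)) (m n m' n' : γ → ℤ) :
    P (latt L m n) - P (latt L m' n') = P (latt L (m - m') (n - n')) := by
  rw [← map_sub]
  congr 1
  funext b; simp [latt]; ring

omit [DecidableEq γ] in
/-- **Uniform discreteness gives finiteness of bounded parts.** [folklore] -/
theorem finite_lattImage_inter_ball (P : (γ → ℂ) →ₗ[ℂ] (γ → ℂ)) {ε : ℝ} (hε : 0 < ε)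
    (hUD : ∀ m n : γ → ℤ, ‖P (latt L m n)‖ < ε → P (latt L m n) = 0) (R : ℝ) :
    {v | v ∈ lattImage L P ∧ ‖v‖ ≤ R}.Finite := by
  by_contra hinf
  have hsub : {v | v ∈ lattImage L P ∧ ‖v‖ ≤ R} ⊆ Metric.closedBall (0 : γ → ℂ) R := fun v hv => by
    simpa using hv.2
  obtain ⟨x, -, hx⟩ := Set.Infinite.exists_accPt_of_subset_isCompact hinf (isCompact_closedBall 0 R) hsub
  rw [accPt_iff_nhds] at hx
  obtain ⟨y₁, ⟨hy₁U, hy₁T⟩, hy₁x⟩ := hx (Metric.ball x (ε / 2)) (Metric.ball_mem_nhds x (by positivity))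
  have hδ : 0 < dist y₁ x := dist_pos.mpr hy₁x
  obtain ⟨y₂, ⟨hy₂U, hy₂T⟩, -⟩ := hx (Metric.ball x (dist y₁ x)) (Metric.ball_mem_nhds x hδ)
  have hne : y₁ ≠ y₂ := by
    intro h; subst h
    exact (lt_irrefl _ (Metric.mem_ball.mp hy₂U))
  have hdist : dist y₁ y₂ < ε := by
    have h1 : dist y₁ x < ε / 2 := Metric.mem_ball.mp hy₁U
    have h2 : dist y₂ x < dist y₁ x := Metric.mem_ball.mp hy₂U
    calc dist y₁ y₂ ≤ dist y₁ x + dist y₂ x := dist_triangle_right _ _ _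
      _ < ε / 2 + ε / 2 := by linarith
      _ = ε := by ring
  obtain ⟨m₁, n₁, h₁⟩ := hy₁T.1
  obtain ⟨m₂, n₂, h₂⟩ := hy₂T.1
  have hsub' : y₁ - y₂ = P (latt L (m₁ - m₂) (n₁ - n₂)) := by rw [h₁, h₂, map_latt_sub]
  have h0 := hUD _ _ (by rw [← hsub', ← dist_eq_norm]; exact hdist)
  rw [← hsub', sub_eq_zero] at h0
  exact hne h0

/-- **Some multiple of each element of a uniformly discrete `P(Λ^γ)` is a lattice vector**, when
`P` is a projection onto a coordinate subspace (reduction into the fundamental parallelogram and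
pigeonhole). [folklore] -/
theorem exists_nsmul_eq_latt {W : Submodule ℂ (γ → ℂ)} {B : Finset γ} (hc : IsCompl (cspan B) W) {ε : ℝ} (hε : 0 < ε)
    (hUD : ∀ m n : γ → ℤ, ‖(cspan B).projection W hc (latt L m n)‖ < ε → (cspan B).projection W hc (latt L m n) = 0)
    {g : γ → ℂ} (hg : g ∈ lattImage L ((cspan B).projection W hc)) :
    ∃ d : ℕ, 0 < d ∧ ∃ m n : γ → ℤ, (d : ℤ) • g = latt L m n := by
  set P := (cspan B).projection W hc with hP
  -- reduction keeps `P(Λ^γ)` (lattice vectors supported on `B` are fixed by `P`)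
  have hredG : ∀ v ∈ lattImage L P, red L v ∈ lattImage L P := by
    intro v hv
    have hvB : v ∈ cspan B := by
      obtain ⟨m, n, rfl⟩ := hv
      exact Submodule.projection_apply_mem hc _
    have hsupp : latt L (mfl L v) (nfl L v) ∈ cspan B := by
      refine mem_cspan_of_support fun b hb => ?_
      obtain ⟨h1, h2⟩ := mfl_eq_zero L (apply_eq_zero_of_mem_cspan hvB hb)
      simp [latt, h1, h2]
    have hfix : P (latt L (mfl L v) (nfl L v)) = latt L (mfl L v) (nfl L v) :=
      Submodule.projection_apply_of_mem_left hc hsupp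
    have hmem : latt L (mfl L v) (nfl L v) ∈ lattImage L P := ⟨_, _, hfix.symm⟩
    exact (lattImage L P).sub_mem hv hmem
  -- pigeonhole on `k ↦ red (k • g)`
  have hfin := finite_lattImage_inter_ball L P hε hUD (‖L.ω₁‖ + ‖L.ω₂‖)
  have hmaps : Set.MapsTo (fun k : ℕ => red L ((k : ℤ) • g)) Set.univ {v | v ∈ lattImage L P ∧ ‖v‖ ≤ ‖L.ω₁‖ + ‖L.ω₂‖} :=
    fun k _ => ⟨hredG _ ((lattImage L P).zsmul_mem hg k), norm_red_le L _⟩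
  obtain ⟨k₁, -, k₂, -, hk, heq⟩ := Set.infinite_univ.exists_ne_map_eq_of_mapsTo hmaps hfin
  -- `(k₁ - k₂) • g` is a lattice vector
  wlog hlt : k₂ < k₁ generalizing k₁ k₂
  · exact this k₂ k₁ hk.symm heq.symm (lt_of_le_of_ne (not_lt.mp hlt) hk)
  refine ⟨k₁ - k₂, Nat.sub_pos_of_lt hlt, mfl L ((k₁ : ℤ) • g) - mfl L ((k₂ : ℤ) • g),
    nfl L ((k₁ : ℤ) • g) - nfl L ((k₂ : ℤ) • g), ?_⟩
  have h : (k₁ : ℤ) • g - latt L (mfl L ((k₁ : ℤ) • g)) (nfl L ((k₁ : ℤ) • g)) =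
      (k₂ : ℤ) • g - latt L (mfl L ((k₂ : ℤ) • g)) (nfl L ((k₂ : ℤ) • g)) := heq
  have hlatt : latt L (mfl L ((k₁ : ℤ) • g)) (nfl L ((k₁ : ℤ) • g)) - latt L (mfl L ((k₂ : ℤ) • g)) (nfl L ((k₂ : ℤ) • g)) =
      latt L (mfl L ((k₁ : ℤ) • g) - mfl L ((k₂ : ℤ) • g)) (nfl L ((k₁ : ℤ) • g) - nfl L ((k₂ : ℤ) • g)) := by
    funext b; simp [latt]; ring
  rw [← hlatt, Nat.cast_sub hlt.le, sub_smul]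
  exact sub_eq_sub_iff_sub_eq_sub.mp h

/-! ### Uniform discreteness forces rationality -/

omit [Fintype γ] in
/-- `ω₁ e_b` and `ω₂ e_b` as lattice vectors. [folklore] -/
theorem latt_single_fst (b : γ) : latt L (Pi.single b 1) 0 = (L.ω₁ : ℂ) • (Pi.single b (1 : ℂ) : γ → ℂ) := by
  funext b'; by_cases h : b' = b
  · subst h; simp [latt]
  · simp [latt, Pi.single_eq_of_ne h]

omit [Fintype γ] in
/-- `ω₁ e_b` and `ω₂ e_b` as lattice vectors. [folklore] -/
theorem latt_single_snd (b : γ) : latt L 0 (Pi.single b 1) = (L.ω₂ : ℂ) • (Pi.single b (1 : ℂ) : γ → ℂ) := by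
  funext b'; by_cases h : b' = b
  · subst h; simp [latt]
  · simp [latt, Pi.single_eq_of_ne h]

/-- Expansion in the coordinate vectors. [folklore] -/
theorem eq_sum_smul_single (v : γ → ℂ) : v = ∑ b, v b • (Pi.single b (1 : ℂ) : γ → ℂ) := by
  funext b'; simp [Finset.sum_apply, Pi.single_apply]

/-- The matrix of a linear map in the coordinate vectors. [folklore] -/
theorem apply_eq_sum_mul (P : (γ → ℂ) →ₗ[ℂ] (γ → ℂ)) (v : γ → ℂ) (b' : γ) :
    P v b' = ∑ b, v b * P (Pi.single b (1 : ℂ)) b' := by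
  have h : P v = ∑ b, v b • P (Pi.single b (1 : ℂ)) := by
    conv_lhs => rw [eq_sum_smul_single v]
    rw [map_sum]
    exact Finset.sum_congr rfl fun b _ => by rw [map_smul]
  rw [h, Finset.sum_apply]
  rfl

/-- **Uniform discreteness of `P(Λ^γ)` forces the rationality of `W = ker P`** (`P` the projection
onto a coordinate complement): then `W` is cut out by its rational relations. This is where
`End(Λ) = ℤ` is used. [folklore] -/
theorem mem_of_forall_zRel (hCM : ¬ L.HasCM) {W : Submodule ℂ (γ → ℂ)} {B : Finset γ} (hc : IsCompl (cspan B) W)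
    {ε : ℝ} (hε : 0 < ε)
    (hUD : ∀ m n : γ → ℤ, ‖(cspan B).projection W hc (latt L m n)‖ < ε → (cspan B).projection W hc (latt L m n) = 0)
    {z : γ → ℂ} (hz : ∀ c ∈ zRel W, ∑ b, (c b : ℂ) * z b = 0) : z ∈ W := by
  set P := (cspan B).projection W hc with hP
  -- a common multiple `N` taking all `P(ω_i e_b)` into `Λ^γ`
  have h1 : ∀ b, ∃ d : ℕ, 0 < d ∧ ∃ m n : γ → ℤ, (d : ℤ) • P (latt L (Pi.single b 1) 0) = latt L m n :=
    fun b => exists_nsmul_eq_latt L hc hε hUD ⟨_, _, rfl⟩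
  have h2 : ∀ b, ∃ d : ℕ, 0 < d ∧ ∃ m n : γ → ℤ, (d : ℤ) • P (latt L 0 (Pi.single b 1)) = latt L m n :=
    fun b => exists_nsmul_eq_latt L hc hε hUD ⟨_, _, rfl⟩
  choose d₁ hd₁ m₁ n₁ hmn₁ using h1
  choose d₂ hd₂ m₂ n₂ hmn₂ using h2
  set N : ℕ := (∏ b, d₁ b) * ∏ b, d₂ b with hN
  have hNpos : 0 < N := Nat.mul_pos (Finset.prod_pos fun b _ => hd₁ b) (Finset.prod_pos fun b _ => hd₂ b)
  have hdvd₁ : ∀ b, d₁ b ∣ N := fun b => (Finset.dvd_prod_of_mem _ (Finset.mem_univ b)).mul_right _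
  have hdvd₂ : ∀ b, d₂ b ∣ N := fun b => (Finset.dvd_prod_of_mem _ (Finset.mem_univ b)).mul_left _
  -- the entries of `P` are rational
  have hcoord : ∀ b b', ∃ k : ℤ, (N : ℂ) * P (Pi.single b (1 : ℂ)) b' = k := by
    intro b b'
    refine int_of_mul_omega_mem L hCM ?_ ?_
    · obtain ⟨e, he⟩ := hdvd₁ b
      have h := congrArg (fun v => ((e : ℤ) • v) b') (hmn₁ b)

      rw [smul_smul, zsmul_latt, latt_single_fst, map_smul] at h
      have : (N : ℂ) * P (Pi.single b 1) b' * L.ω₁ = (((e : ℤ) * (d₁ b : ℤ)) • ((L.ω₁ : ℂ) • P (Pi.single b 1))) b' := by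
        rw [he]; simp [Pi.smul_apply, zsmul_eq_mul]; ring
      rw [this, h]
      exact PeriodPair.mem_lattice.mpr ⟨_, _, rfl⟩
    · obtain ⟨e, he⟩ := hdvd₂ b
      have h := congrArg (fun v => ((e : ℤ) • v) b') (hmn₂ b)

      rw [smul_smul, zsmul_latt, latt_single_snd, map_smul] at h
      have : (N : ℂ) * P (Pi.single b 1) b' * L.ω₂ = (((e : ℤ) * (d₂ b : ℤ)) • ((L.ω₂ : ℂ) • P (Pi.single b 1))) b' := by
        rw [he]; simp [Pi.smul_apply, zsmul_eq_mul]; ring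
      rw [this, h]
      exact PeriodPair.mem_lattice.mpr ⟨_, _, rfl⟩
  choose k hk using hcoord
  have hq : ∀ b b', P (Pi.single b (1 : ℂ)) b' = (((k b b' : ℚ) / N : ℚ) : ℂ) := by
    intro b b'
    have hN0 : (N : ℂ) ≠ 0 := by exact_mod_cast hNpos.ne'
    push_cast
    rw [← hk b b']
    field_simp
  -- the rows of `P` are rational relations of `W`
  have hrow : ∀ b', (fun b => (k b b' : ℚ) / N) ∈ zRel W := by
    intro b' x hx
    have : P x b' = 0 := by rw [(Submodule.projection_apply_eq_zero_iff hc).mpr hx]; rfl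
    rw [apply_eq_sum_mul] at this
    rw [← this]
    exact Finset.sum_congr rfl fun b _ => by rw [hq b b', mul_comm]
  -- hence `P z = 0`
  have hPz : P z = 0 := by
    funext b'
    rw [apply_eq_sum_mul, Pi.zero_apply, ← hz _ (hrow b')]
    exact Finset.sum_congr rfl fun b _ => by rw [hq b b', mul_comm]
  exact (Submodule.projection_apply_eq_zero_iff hc).mp hPz

/-! ### The Kronecker lemma -/

/-- **Entire functions with `Λ^γ`-invariant zero set vanishing on `𝔷` vanish on `ratHull 𝔷`**
(no complex multiplication). [folklore] -/
theorem eq_zero_on_ratHull (hCM : ¬ L.HasCM) {g : (γ → ℂ) → ℂ} (hg : Differentiable ℂ g)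
    (hper : ∀ z, g z = 0 → ∀ m n : γ → ℤ, g (z + latt L m n) = 0)
    (𝔷 : Submodule ℂ (γ → ℂ)) (h0 : ∀ z ∈ 𝔷, g z = 0) : ∀ z ∈ ratHull 𝔷, g z = 0 := by
  -- induction on the codimension of a subspace of the zero set containing `𝔷`
  suffices aux : ∀ (k : ℕ) (W : Submodule ℂ (γ → ℂ)), 𝔷 ≤ W → (∀ w ∈ W, g w = 0) →
      finrank ℂ (γ → ℂ) - finrank ℂ W ≤ k → ∀ z ∈ ratHull 𝔷, g z = 0 from
    aux _ 𝔷 le_rfl h0 le_rfl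
  intro k
  induction k with
  | zero =>
    intro W h𝔷W hW hk z _
    have htop : W = ⊤ := Submodule.eq_top_of_finrank_eq (le_antisymm (Submodule.finrank_le W) (by omega))
    exact hW z (htop ▸ Submodule.mem_top)
  | succ k ih =>
    intro W h𝔷W hW hk
    obtain ⟨B, hcW⟩ := exists_isCompl_cspan W
    have hc : IsCompl (cspan B) W := hcW.symm
    set P := (cspan B).projection W hc with hP
    by_cases hUD : ∃ ε : ℝ, 0 < ε ∧ ∀ m n : γ → ℤ, ‖P (latt L m n)‖ < ε → P (latt L m n) = 0
    · -- uniformly discrete: `W` is rational, `ratHull 𝔷 ≤ W`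
      obtain ⟨ε, hε, hUD⟩ := hUD
      intro z hz
      exact hW z (ratHull_le_of_le h𝔷W (fun z' hz' => mem_of_forall_zRel L hCM hc hε hUD hz') hz)
    · -- small elements: a new direction `u` in the zero set
      have hsmall : ∀ ε : ℝ, 0 < ε → ∃ s ∈ lattImage L P, s ≠ 0 ∧ ‖s‖ < ε := by
        intro ε hε
        by_contra h
        apply hUD
        refine ⟨ε, hε, fun m n hmn => ?_⟩
        by_contra hne
        exact h ⟨_, ⟨m, n, rfl⟩, hne, hmn⟩
      obtain ⟨u, huB, hu0, hline⟩ := exists_line_subset_closure (lattImage L P) (cspan B)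
        (by rintro _ ⟨m, n, rfl⟩; exact Submodule.projection_apply_mem hc _) hsmall
      have huW : u ∉ W := fun h => hu0 ((Submodule.disjoint_def.mp hc.disjoint) u huB h)
      -- the closure of `P(Λ^γ)` translated by `W` stays in the zero set
      have hT : closure (lattImage L P : Set (γ → ℂ)) ⊆ {v | ∀ w ∈ W, g (w + v) = 0} := by
        refine closure_minimal ?_ ?_
        · rintro _ ⟨m, n, rfl⟩ w hw
          have hdiff : latt L m n - P (latt L m n) ∈ W := by
            rw [← Submodule.projection_apply_eq_zero_iff hc, map_sub,
              Submodule.projection_apply_of_mem_left hc (Submodule.projection_apply_mem hc _), sub_self]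
          have hw' : w - (latt L m n - P (latt L m n)) ∈ W := W.sub_mem hw hdiff
          have := hper _ (hW _ hw') m n
          rwa [show w - (latt L m n - P (latt L m n)) + latt L m n = w + P (latt L m n) by abel] at this
        · have : {v : γ → ℂ | ∀ w ∈ W, g (w + v) = 0} = ⋂ w ∈ W, (fun v => g (w + v)) ⁻¹' {0} := by
            ext v; simp
          rw [this]
          exact isClosed_biInter fun w _ => isClosed_singleton.preimage (hg.continuous.comp (continuous_const.add continuous_id))
      have hreal : ∀ w ∈ W, ∀ t : ℝ, g (w + (t : ℂ) • u) = 0 := fun w hw t => hT (hline t) w hw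
      have hcx : ∀ w ∈ W, ∀ τ : ℂ, g (w + τ • u) = 0 := fun w hw τ => eq_zero_smul_of_real hg (hreal w hw) τ
      -- the bigger subspace
      set W' := W ⊔ Submodule.span ℂ {u} with hW'
      have hW'zero : ∀ w ∈ W', g w = 0 := by
        intro w hw
        obtain ⟨x, hx, v, hv, rfl⟩ := Submodule.mem_sup.mp hw
        obtain ⟨τ, rfl⟩ := Submodule.mem_span_singleton.mp hv
        exact hcx x hx τ
      have hlt : W < W' := by
        refine lt_of_le_of_ne le_sup_left fun h => huW ?_
        rw [h]
        exact Submodule.mem_sup_right (Submodule.mem_span_singleton_self u)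
      have hrank := Submodule.finrank_lt_finrank_of_lt hlt
      exact ih W' (h𝔷W.trans hlt.le) hW'zero (by omega)

end Kron

end Literature.NumberTheory.Transcendental

end
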